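import Summits.BirchSwinnertonDyer.BirchSwinnertonDyer.Theses.FrozenTwin
import Literature.NumberTheory.EllipticCurves.IwasawaLeadingTermProofs

/-!
# `SelmerRankCM` (crux stmt-BirchSwinnertonDyer-18086; byte-identical in routes FrozenTwin /
# TangentCone / SelmerRank / ShadowIsolation / ToricShedding): what any proof must deliver —
# WITHOUT any `Ш`-hypothesis the crux already proves weak BSD `rank ≤ r_an` for every CM curve,
# pins `corank_{ℤ_p} Ш[p^∞] = r_an − rank` at EVERY good ordinary `p ≥ 5`, and makes
# `Ш(E)[p^∞]`-finiteness prime-independent on that locus (negative-side support, refuter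
# crux-disprover seat cdisprove-18086, cycle 1; lower bounds on difficulty, NOT a refutation)

Write `C` for the crux: for `W/ℚ` elliptic, globally minimal, with complex multiplication, and a
prime `p ≥ 5` of good ordinary reduction, `corank_{ℤ_p} Sel_{p^∞}(W/ℚ) = ord_{s=1} L(W,s)`.
The standing disproof file (`Cruxes/SelmerRankCM/Disproof.lean`, §3) showed `C ∧ SelmerRankShaPFinite
⟹ BSD on CM curves`. Here the `Ш` item is REMOVED from that statement: Greenberg's corank identity
`corank Sel_{p^∞} = rank + corank Ш[p^∞]` is a THEOREM of the tree
(`WeierstrassCurve.selmerCorank_eq_mordellWeilRank_add_holds`), a good ordinary prime `p ≥ 5`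
exists for every curve (`WeierstrassCurve.exists_good_ordinary_prime_holds`, THEOREM), and
`Ш[p^∞]` is finite iff its corank vanishes
(`finite_primaryComponent_sha_iff_shaCorank_eq_zero`, THEOREM). Hence, sorry-free:

* `mordellWeilRank_add_shaCorank_eq_analyticRank_of_crux` — `C ⟹ rank + corank Ш[p^∞] = r_an`
  at every good ordinary `p ≥ 5` of a CM curve;
* `mordellWeilRank_le_analyticRank_of_crux` — `C ⟹ rank E(ℚ) ≤ ord_{s=1} L(E,s)` for EVERY CM
  elliptic curve over `ℚ` (global minimal model): the upper-bound half of the BSD rank conjecture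
  in the CM sector, open in print once `r_an ≥ 2` (Rubin/Kato bound `rank` by `ord_T` of a
  `p`-adic `L`-function, not by `r_an`);
* `shaCorank_eq_of_crux` — `C ⟹ corank_{ℤ_p} Ш[p^∞] = corank_{ℤ_q} Ш[q^∞]` for any two good
  ordinary `p, q ≥ 5`; `selmerCorank_eq_of_crux` — the Selmer corank is prime-independent there;
* `finite_sha_iff_rank_eq_analyticRank_of_crux` — `C ⟹ (Ш[p^∞] finite ↔ rank = r_an)` at every
  good ordinary `p ≥ 5`; hence `finite_sha_iff_finite_sha_of_crux` — `Ш[p^∞]` finite at ONE such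
  prime iff at ALL of them, and `bsd_iff_exists_finite_sha_of_crux` — for a CM curve, BSD-rank
  holds iff `Ш[p^∞]` is finite at some good ordinary `p ≥ 5`.

So a proof of `C` is, prime by prime on the ordinary locus, a proof of "`Ш[p^∞]` infinite
exactly to the extent `r_an − rank`": the crux CONTAINS the CM case of weak BSD and ties every
ordinary `Ш[p^∞]` to the single integer `r_an − rank`. Planners weighing `C` against the route's
`Ш` item `SelmerRankShaPFinite` (stmt-0132): on CM curves `C` makes 0132-at-one-ordinary-prime
equivalent to 0132-at-all-ordinary-primes and to BSD-rank itself.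
-/

noncomputable section

-- D-0017: single-problem summit, so `Summit.BirchSwinnertonDyer.BirchSwinnertonDyer.…` repeats a
-- namespace BY DESIGN.
set_option linter.dupNamespace false

namespace Summit.BirchSwinnertonDyer.BirchSwinnertonDyer.Theorems.SelmerRankCM.Negative

open Literature.NumberTheory.EllipticCurves
open Summit.BirchSwinnertonDyer.BirchSwinnertonDyer.Theses

section Consequences

variable (hC : FrozenTwin.SelmerRankCM)
include hC

/-- **`C ⟹ rank + corank_{ℤ_p} Ш[p^∞] = r_an`** at every good ordinary `p ≥ 5` of a CM curve
(global minimal model): the crux read through Greenberg's proved corank identity.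
[cite: GreenbergLNM1716, §1] -/
theorem mordellWeilRank_add_shaCorank_eq_analyticRank_of_crux (W : WeierstrassCurve ℚ)
    [W.IsElliptic] [W.IsGloballyMinimal] (p : ℕ) [Fact p.Prime] (h5 : 5 ≤ p)
    (hgood : W.HasGoodReductionAtPrime p) (hord : ¬ (p : ℤ) ∣ W.frobeniusTrace p) (hCM : W.HasCM) :
    W.mordellWeilRank + W.shaCorank p = W.analyticRank := by
  rw [← W.selmerCorank_eq_mordellWeilRank_add_holds p]
  exact hC W p h5 hgood hord hCM

/-- **`C ⟹` weak BSD `rank E(ℚ) ≤ ord_{s=1} L(E,s)` for every CM elliptic curve over `ℚ`**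
(global minimal model), with NO `Ш`-hypothesis: pick any good ordinary `p ≥ 5`
(`exists_good_ordinary_prime_holds`) and drop the `Ш`-corank from the previous identity.
[folklore] -/
theorem mordellWeilRank_le_analyticRank_of_crux (W : WeierstrassCurve ℚ) [W.IsElliptic]
    [W.IsGloballyMinimal] (hCM : W.HasCM) : W.mordellWeilRank ≤ W.analyticRank := by
  obtain ⟨p, hp, h5, hgood, hord⟩ := WeierstrassCurve.exists_good_ordinary_prime_holds W
  have h := mordellWeilRank_add_shaCorank_eq_analyticRank_of_crux hC W p h5 hgood hord hCM
  omega

/-- **`C ⟹ corank_{ℤ_p} Ш[p^∞] = r_an − rank`** (natural subtraction is exact here, by the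
previous two results). [folklore] -/
theorem shaCorank_eq_analyticRank_sub_of_crux (W : WeierstrassCurve ℚ) [W.IsElliptic]
    [W.IsGloballyMinimal] (p : ℕ) [Fact p.Prime] (h5 : 5 ≤ p)
    (hgood : W.HasGoodReductionAtPrime p) (hord : ¬ (p : ℤ) ∣ W.frobeniusTrace p) (hCM : W.HasCM) :
    W.shaCorank p = W.analyticRank - W.mordellWeilRank := by
  have h := mordellWeilRank_add_shaCorank_eq_analyticRank_of_crux hC W p h5 hgood hord hCM
  omega

/-- **`C ⟹` the `Ш`-corank is the same at any two good ordinary primes `p, q ≥ 5`** of a CM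
curve. [folklore] -/
theorem shaCorank_eq_of_crux (W : WeierstrassCurve ℚ) [W.IsElliptic] [W.IsGloballyMinimal]
    (hCM : W.HasCM) (p q : ℕ) [Fact p.Prime] [Fact q.Prime] (hp5 : 5 ≤ p)
    (hpgood : W.HasGoodReductionAtPrime p) (hpord : ¬ (p : ℤ) ∣ W.frobeniusTrace p) (hq5 : 5 ≤ q)
    (hqgood : W.HasGoodReductionAtPrime q) (hqord : ¬ (q : ℤ) ∣ W.frobeniusTrace q) :
    W.shaCorank p = W.shaCorank q := by
  have hp := mordellWeilRank_add_shaCorank_eq_analyticRank_of_crux hC W p hp5 hpgood hpord hCM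
  have hq := mordellWeilRank_add_shaCorank_eq_analyticRank_of_crux hC W q hq5 hqgood hqord hCM
  omega

/-- **`C ⟹` the Selmer corank is prime-independent on the good ordinary locus `p ≥ 5`** of a CM
curve (both equal `r_an`). [folklore] -/
theorem selmerCorank_eq_of_crux (W : WeierstrassCurve ℚ) [W.IsElliptic] [W.IsGloballyMinimal]
    (hCM : W.HasCM) (p q : ℕ) [Fact p.Prime] [Fact q.Prime] (hp5 : 5 ≤ p)
    (hpgood : W.HasGoodReductionAtPrime p) (hpord : ¬ (p : ℤ) ∣ W.frobeniusTrace p) (hq5 : 5 ≤ q)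
    (hqgood : W.HasGoodReductionAtPrime q) (hqord : ¬ (q : ℤ) ∣ W.frobeniusTrace q) :
    W.selmerCorank p = W.selmerCorank q := by
  rw [hC W p hp5 hpgood hpord hCM, hC W q hq5 hqgood hqord hCM]

/-- **`C ⟹ (Ш(E)[p^∞] finite ↔ rank E(ℚ) = ord_{s=1} L(E,s))`** at every good ordinary `p ≥ 5`
of a CM curve: finiteness is corank zero (`finite_primaryComponent_sha_iff_shaCorank_eq_zero`,
proved), and the corank is `r_an − rank`. [folklore] -/
theorem finite_sha_iff_rank_eq_analyticRank_of_crux (W : WeierstrassCurve ℚ) [W.IsElliptic]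
    [W.IsGloballyMinimal] (p : ℕ) [Fact p.Prime] (h5 : 5 ≤ p)
    (hgood : W.HasGoodReductionAtPrime p) (hord : ¬ (p : ℤ) ∣ W.frobeniusTrace p) (hCM : W.HasCM) :
    Finite (AddCommGroup.primaryComponent W.sha p) ↔ W.mordellWeilRank = W.analyticRank := by
  rw [finite_primaryComponent_sha_iff_shaCorank_eq_zero]
  have h := mordellWeilRank_add_shaCorank_eq_analyticRank_of_crux hC W p h5 hgood hord hCM
  omega

/-- **`C ⟹ Ш[p^∞]`-finiteness at ONE good ordinary prime `≥ 5` is equivalent to finiteness at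
ANY other** (CM curve, global minimal model). [folklore] -/
theorem finite_sha_iff_finite_sha_of_crux (W : WeierstrassCurve ℚ) [W.IsElliptic]
    [W.IsGloballyMinimal] (hCM : W.HasCM) (p q : ℕ) [Fact p.Prime] [Fact q.Prime] (hp5 : 5 ≤ p)
    (hpgood : W.HasGoodReductionAtPrime p) (hpord : ¬ (p : ℤ) ∣ W.frobeniusTrace p) (hq5 : 5 ≤ q)
    (hqgood : W.HasGoodReductionAtPrime q) (hqord : ¬ (q : ℤ) ∣ W.frobeniusTrace q) :
    Finite (AddCommGroup.primaryComponent W.sha p) ↔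
      Finite (AddCommGroup.primaryComponent W.sha q) := by
  rw [finite_sha_iff_rank_eq_analyticRank_of_crux hC W p hp5 hpgood hpord hCM,
    finite_sha_iff_rank_eq_analyticRank_of_crux hC W q hq5 hqgood hqord hCM]

/-- **`C ⟹` for a CM curve, BSD-rank `rank = r_an` holds iff `Ш[p^∞]` is finite at SOME good
ordinary prime `p ≥ 5`** (one always exists). So on CM curves the crux turns the route's
prime-by-prime `Ш` item (stmt-0132) at a single ordinary prime into the summit's conclusion.
[folklore] -/
theorem bsd_iff_exists_finite_sha_of_crux (W : WeierstrassCurve ℚ) [W.IsElliptic]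
    [W.IsGloballyMinimal] (hCM : W.HasCM) :
    W.mordellWeilRank = W.analyticRank ↔
      ∃ (p : ℕ) (_ : Fact p.Prime), 5 ≤ p ∧ W.HasGoodReductionAtPrime p ∧
        ¬ (p : ℤ) ∣ W.frobeniusTrace p ∧ Finite (AddCommGroup.primaryComponent W.sha p) := by
  obtain ⟨p, hp, h5, hgood, hord⟩ := WeierstrassCurve.exists_good_ordinary_prime_holds W
  constructor
  · intro h
    exact ⟨p, hp, h5, hgood, hord,
      (finite_sha_iff_rank_eq_analyticRank_of_crux hC W p h5 hgood hord hCM).2 h⟩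
  · rintro ⟨q, hq, hq5, hqgood, hqord, hfin⟩
    exact (finite_sha_iff_rank_eq_analyticRank_of_crux hC W q hq5 hqgood hqord hCM).1 hfin

/-- **`C ⟹` an infinite `Ш[p^∞]` at one good ordinary `p ≥ 5` forces `rank < r_an` AND an
infinite `Ш[q^∞]` at EVERY good ordinary `q ≥ 5`** — the shape a counterexample to BSD-rank
would have to take inside the crux. [folklore] -/
theorem rank_lt_analyticRank_of_crux_of_infinite_sha (W : WeierstrassCurve ℚ) [W.IsElliptic]
    [W.IsGloballyMinimal] (hCM : W.HasCM) (p : ℕ) [Fact p.Prime] (hp5 : 5 ≤ p)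
    (hpgood : W.HasGoodReductionAtPrime p) (hpord : ¬ (p : ℤ) ∣ W.frobeniusTrace p)
    (hinf : ¬ Finite (AddCommGroup.primaryComponent W.sha p)) :
    W.mordellWeilRank < W.analyticRank ∧
      ∀ (q : ℕ) [Fact q.Prime], 5 ≤ q → W.HasGoodReductionAtPrime q →
        ¬ (q : ℤ) ∣ W.frobeniusTrace q → ¬ Finite (AddCommGroup.primaryComponent W.sha q) := by
  refine ⟨?_, fun q _ hq5 hqgood hqord hfin => hinf
    ((finite_sha_iff_finite_sha_of_crux hC W hCM p q hp5 hpgood hpord hq5 hqgood hqord).2 hfin)⟩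
  have hle := mordellWeilRank_le_analyticRank_of_crux hC W hCM
  have hne : W.mordellWeilRank ≠ W.analyticRank := fun h =>
    hinf ((finite_sha_iff_rank_eq_analyticRank_of_crux hC W p hp5 hpgood hpord hCM).2 h)
  omega

end Consequences

end Summit.BirchSwinnertonDyer.BirchSwinnertonDyer.Theorems.SelmerRankCM.Negative

end
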